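import Summits.CriticalPhenomena.PercolationContinuityZ3.Theorems.PercAnnulusCrossingIICNearCriticalUniform
import Summits.CriticalPhenomena.PercolationContinuityZ3.Theorems.PercAnnulusCrossingIICNearCriticalJunkControl
import Summits.CriticalPhenomena.PercolationContinuityZ3.Theorems.PercAnnulusCrossingIICNearCriticalLevelJunk
import HarnessLib

/-!
# Kesten's IIC scheme under (A2)□ run on the UNIQUENESS junk, uniformly on compact sets of edge densities — NEAR-CRITICAL series XI
# (lane RSW3, p1 gen 6)

builds on p205010 (kernel theorem, internal audit signed; external expert review pending) — not used by this file's theorems.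

Seat `prim-rsw3-p1` (gen 6).  Instantiation of the abstract scheme (series II–VI, IX, X) at the junk weight `J p m₁ m₂ = √P_p(NONUNIQ(σ m₁, σ m₂))`
(series I: the level-junk inequality; series VIII: UNIFORM junk control on every compact `S ⊂ (0,1)`, by uniqueness of the infinite cluster at
every `p` + finite energy + Dini).  The main output is the UNIFORM oscillation estimate `iic_ratio_osc_uniform_of_setToSetQM_aspect` — the
input of Basu–Sapozhnikov's (2.1) ("`P_p[E | w ↔ S(w,n)]` converges UNIFORMLY on `[p_c, p_c + δ]`"), from which series XII derives the continuity
of `p ↦ ν_p(E)` and Kesten's second construction `lim_{p ↓ p_c} P_p(E | |C(0)| = ∞) = ν(E)`.  As by-products, pointwise corollaries: Kesten's IIC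
exists under (A2)□ at any `0 < p < 1` by THIS route (uniqueness junk), in particular at `p_c(ℤ^d)` with Basu–Sapozhnikov's own hypotheses
(A1) = uniqueness (Burton–Keane, tree) and (A2), and WITHOUT `θ(p_c) = 0`.  (Honesty note: the pointwise every-`p` statement is already in the
tree as `kestenIICExistsAt_of_setToSetQuasiMultAspectAt'` (`…IICAspectCorollaries.lean`) by the case split `θ(p) > 0` (trivial limit) /
`θ(p) = 0` (part XX′), which also covers `p_c` without p205010; what the case split cannot give is the UNIFORMITY in `p`, since its modulus
degenerates as `θ(p) ↓ 0`.)  Helper file; no definitions, no sorries.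
* **`iic_ratio_osc_uniform_of_setToSetQM_aspect`** — `d ≥ 1`, `S ⊂ (0,1)` compact, (A2)□(ϰ; σ, τ) at every `p ∈ S` ⇒ for every cylinder `E`
  and `δ > 0` ONE threshold `N` with `|P_p(E | 0 ↔ ∂ⁱⁿΛ(n)) − P_p(E | 0 ↔ ∂ⁱⁿΛ(n'))| ≤ δ` for all `p ∈ S`, `N ≤ n' ≤ n`;
* `kestenIICExistsAt_of_setToSetQM_aspect_uniq`, `kestenIICExistsAt_of_setToSetQuasiMultAspectAt_uniq` — `0 < p < 1`, (A2)□ at `p` ⇒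
  `KestenIICExistsAt d p`, via the uniqueness junk;
  (At `p_c(ℤ^d)` this specialises — `0 < p_c < 1` from the tree — to the statements of `kestenIICExistsAt_criticalProbI_of_setToSetQuasiMultAspectAt` /
  `kestenIICExists_of_setToSetQuasiMult`, already in the tree; not restated.  No `θ = 0` in the dependency cone of the `_uniq` theorems:
  checked mechanically, the `CSH.*` theorems are not among the ≈ 32 500 constants used; `Grimmett1999_numInfiniteClusters_le_one_holds` is.)
References: D. Basu, A. Sapozhnikov, ECP 22 (2017) no. 26, Thm. 1.1, §1 (A1), §2 (2.1); H. Kesten, PTRF 73 (1986) Thm. (3); G. Grimmett (1999),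
§8.2 (uniqueness), §1.4 (`0 < p_c < 1`).
-/

noncomputable section

namespace Summit.CriticalPhenomena.PercolationContinuityZ3.Theorems.Crossing

open MeasureTheory Filter Topology Literature.Probability.Percolation Literature.Probability.LatticeModels
open Literature.Probability.Percolation.DCT16 Literature.Probability.Percolation.DKT20
open Summit.CriticalPhenomena.PercolationContinuityZ3.Theorems.SurfaceTension
open scoped Literature.Probability.Percolation

variable {d : ℕ}

/-- **Uniform oscillation estimate of the IIC ratios under (A2)□, on a compact set of densities `S ⊂ (0,1)`** (junk `√P(NONUNIQ)`, no
`θ = 0`): see the module docstring. [cite: BasuSapozhnikov2017ECP, §2 eq. (2.1)] [cite: Kesten1986, Thm. (3)] -/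
theorem iic_ratio_osc_uniform_of_setToSetQM_aspect (hd : 1 ≤ d) {S : Set unitInterval} (hS : IsCompact S)
    (hS0 : ∀ p ∈ S, 0 < (p : ℝ)) (hS1 : ∀ p ∈ S, (p : ℝ) < 1)
    {ϰ : ℝ} (hϰ : 0 < ϰ)
    {σ τ : ℕ → ℕ} (hσ : ∀ m : ℕ, 1 ≤ m → m < σ m) (hστ : ∀ m : ℕ, 1 ≤ m → σ m < τ m)
    (hσm : Monotone σ) (hτm : Monotone τ)
    (hA2 : ∀ p ∈ S, ∀ m : ℕ, 1 ≤ m → ∀ Z : Finset (Site d), box d (τ m) \ box d (m - 1) ⊆ Z →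
      ∀ X : Finset (Site d), X ⊆ Z ∩ box d m → ∀ Y : Finset (Site d), Y ⊆ Z \ box d (τ m) →
        ϰ * (bondPercolation (zdGraph d) p).real {ω | ∃ x ∈ X, ∃ s ∈ innerBoundary (zdGraph d) (box d (σ m)),
              ω ∈ openConnIn (↑Z : Set (Site d)) x s} *
          (bondPercolation (zdGraph d) p).real {ω | ∃ y ∈ Y, ∃ s ∈ innerBoundary (zdGraph d) (box d (σ m)),
              ω ∈ openConnIn (↑Z : Set (Site d)) y s} ≤
        (bondPercolation (zdGraph d) p).real {ω | ∃ x ∈ X, ∃ y ∈ Y, ω ∈ openConnIn (↑Z : Set (Site d)) x y})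
    (F : Finset (Sym2 (Site d))) (E : Set (BondConfig (Site d))) (hEF : DeterminedBy E ↑F) {δ : ℝ} (hδ : 0 < δ) :
    ∃ N : ℕ, ∀ p ∈ S, ∀ n n' : ℕ, N ≤ n' → n' ≤ n →
      |(bondPercolation (zdGraph d) p).real (E ∩ siteToBoundary d n) / oneArmProb d p n -
        (bondPercolation (zdGraph d) p).real (E ∩ siteToBoundary d n') / oneArmProb d p n'| ≤ δ :=
  iic_ratio_osc_uniform_of_junk hd hS0 hϰ hσ hστ hσm hτm hA2
    (fun p m₁ m₂ => Real.sqrt ((bondPercolation (zdGraph d) p).real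
      {ω : BondConfig (Site d) | ∃ t₁ ∈ innerBoundary (zdGraph d) (box d (σ m₁)), ∃ w₁ ∈ innerBoundary (zdGraph d) (box d (σ m₂)),
          ∃ t₂ ∈ innerBoundary (zdGraph d) (box d (σ m₁)), ∃ w₂ ∈ innerBoundary (zdGraph d) (box d (σ m₂)),
          ω ∩ {e : Sym2 (Site d) | e ∈ (↑((box d (σ m₂)).sym2) : Set (Sym2 (Site d))) ∧
              ¬ (∀ v ∈ e, v ∈ box d (σ m₁)) ∧ ¬ (∀ v ∈ e, v ∈ innerBoundary (zdGraph d) (box d (σ m₂)))} ∈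
            openConnIn (↑(box d (σ m₂)) : Set (Site d)) t₁ w₁ ∧
          ω ∩ {e : Sym2 (Site d) | e ∈ (↑((box d (σ m₂)).sym2) : Set (Sym2 (Site d))) ∧
              ¬ (∀ v ∈ e, v ∈ box d (σ m₁)) ∧ ¬ (∀ v ∈ e, v ∈ innerBoundary (zdGraph d) (box d (σ m₂)))} ∈
            openConnIn (↑(box d (σ m₂)) : Set (Site d)) t₂ w₂ ∧
          ω ∩ {e : Sym2 (Site d) | e ∈ (↑((box d (σ m₂)).sym2) : Set (Sym2 (Site d))) ∧
              ¬ (∀ v ∈ e, v ∈ box d (σ m₁)) ∧ ¬ (∀ v ∈ e, v ∈ innerBoundary (zdGraph d) (box d (σ m₂)))} ∉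
            openConnIn (↑(box d (σ m₂)) : Set (Site d)) w₁ w₂}))
    (fun p hpS _ _ _ h1 h2 h3 h4 _ _ hH hX hXH =>
      real_conn_inter_nonuniq_le_sqrt_of_setToSetQM_aspect p hϰ.le hσ hστ (hA2 p hpS) h1 h2 h3 h4 hH hX hXH)
    (fun _ hη a B => exists_forall_sqrt_real_nonuniq_le hS hS1 hη hσ a B) F E hEF hδ

/-- **Kesten's IIC exists under (A2)□ (abstract `σ, τ`) at any `0 < p < 1`, via the uniqueness junk** (`d ≥ 1`; no `θ(p) = 0`): the ratio
sequence is Cauchy by the oscillation estimate on `S = {p}`.  (Pointwise this is also `kestenIICExistsAt_of_setToSetQuasiMultAspectAt'` by a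
case split on `θ(p)`; the present route is the one that is uniform in `p`.)
[cite: BasuSapozhnikov2017ECP, Thm. 1.1 ("if (A1) and (A2) are satisfied at p = p_c, then the first limit exists")] [cite: Kesten1986, Thm. (3)] -/
theorem kestenIICExistsAt_of_setToSetQM_aspect_uniq (hd : 1 ≤ d) (p : unitInterval) (hp0 : 0 < (p : ℝ)) (hp1 : (p : ℝ) < 1)
    {ϰ : ℝ} (hϰ : 0 < ϰ)
    {σ τ : ℕ → ℕ} (hσ : ∀ m : ℕ, 1 ≤ m → m < σ m) (hστ : ∀ m : ℕ, 1 ≤ m → σ m < τ m)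
    (hσm : Monotone σ) (hτm : Monotone τ)
    (hA2 : ∀ m : ℕ, 1 ≤ m → ∀ Z : Finset (Site d), box d (τ m) \ box d (m - 1) ⊆ Z →
      ∀ X : Finset (Site d), X ⊆ Z ∩ box d m → ∀ Y : Finset (Site d), Y ⊆ Z \ box d (τ m) →
        ϰ * (bondPercolation (zdGraph d) p).real {ω | ∃ x ∈ X, ∃ s ∈ innerBoundary (zdGraph d) (box d (σ m)),
              ω ∈ openConnIn (↑Z : Set (Site d)) x s} *
          (bondPercolation (zdGraph d) p).real {ω | ∃ y ∈ Y, ∃ s ∈ innerBoundary (zdGraph d) (box d (σ m)),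
              ω ∈ openConnIn (↑Z : Set (Site d)) y s} ≤
        (bondPercolation (zdGraph d) p).real {ω | ∃ x ∈ X, ∃ y ∈ Y, ω ∈ openConnIn (↑Z : Set (Site d)) x y}) :
    KestenIICExistsAt d p := by
  intro F E _ hEF
  have hC : CauchySeq (fun n : ℕ => (bondPercolation (zdGraph d) p).real (E ∩ siteToBoundary d n) / oneArmProb d p n) := by
    refine Metric.cauchySeq_iff'.2 fun δ hδ => ?_
    obtain ⟨N, hN⟩ := iic_ratio_osc_uniform_of_setToSetQM_aspect hd (S := {p}) isCompact_singleton
      (fun q hq => by rw [Set.mem_singleton_iff.1 hq]; exact hp0) (fun q hq => by rw [Set.mem_singleton_iff.1 hq]; exact hp1)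
      hϰ hσ hστ hσm hτm (fun q hq => by rw [Set.mem_singleton_iff.1 hq]; exact hA2) F E hEF (half_pos hδ)
    refine ⟨N, fun n hn => ?_⟩
    rw [Real.dist_eq]
    exact lt_of_le_of_lt (hN p rfl n N le_rfl hn) (half_lt_self hδ)
  exact cauchySeq_tendsto_of_complete hC

/-- **Kesten's IIC exists under (A2)□ AT ASPECT `(s, L)` at any `0 < p < 1`, via the uniqueness junk** (`d ≥ 1`, `2 ≤ s`, any `L`, `ϰ > 0`):
part XX′'s `kestenIICExistsAt_of_setToSetQuasiMultAspectAt` with the junk priced by conditional non-uniqueness instead of `θ(p) = 0`.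
[cite: BasuSapozhnikov2017ECP, Thm. 1.1] [cite: Kesten1986, Thm. (3)] -/
theorem kestenIICExistsAt_of_setToSetQuasiMultAspectAt_uniq (hd : 1 ≤ d) (p : unitInterval) (hp0 : 0 < (p : ℝ)) (hp1 : (p : ℝ) < 1)
    {s L : ℕ} (hs : 2 ≤ s) {ϰ : ℝ} (hϰ : 0 < ϰ) (hA2 : SetToSetQuasiMultAspectAt d p s L ϰ) :
    KestenIICExistsAt d p := by
  have hA2' : SetToSetQuasiMultAspectAt d p s (max L (s + 1)) ϰ := hA2.mono_outer (le_max_left _ _)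
  refine kestenIICExistsAt_of_setToSetQM_aspect_uniq hd p hp0 hp1 hϰ (σ := fun m => s * m) (τ := fun m => max L (s + 1) * m)
    (fun m hm => ?_) (fun m hm => ?_) (fun a b hab => Nat.mul_le_mul_left s hab) (fun a b hab => Nat.mul_le_mul_left _ hab)
    (fun m hm Z hZ X hX Y hY => by rw [mul_assoc]; exact hA2' m hm Z hZ X hX Y hY)
  · have := Nat.mul_le_mul_right m hs; omega
  · exact Nat.mul_lt_mul_of_pos_right (lt_of_lt_of_le (Nat.lt_succ_self s) (le_max_right _ _)) (by omega)

end Summit.CriticalPhenomena.PercolationContinuityZ3.Theorems.Crossing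

end
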